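import Mathlib
import Summits.ResolutionOfSingularities.ResolutionOfSingularities.Theorems.WeightedInvariantLocalWeightedDropWildMonicShift
import Summits.ResolutionOfSingularities.ResolutionOfSingularities.Theorems.WeightedInvariantLocalWeightedDropWildMonicWClean

/-!
# `WeightedInvariant.LocalWeightedDrop`, line `hasse-ridge-face-selection`, S3ρ sub-stub S3ρD `stub_wildMonicSurfaceDescent`:
# weighted orders of a monic tuple under RE-CENTRING `y ↦ y + g` (Perlega Lemma 5.1.1) — the tools

Crux item stmt-ResolutionOfSingularities-8899 `LocalWeightedDrop` (route `ResolutionOfSingularities/WeightedInvariant`), engine of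
the door `HypersurfaceCentreConstruction` stmt-ResolutionOfSingularities-19897.  [OURS · L1 W4.3, chain w43, res-L1-w43-stub-7 (second
seat on S3ρ under res-type-083); item (C2) of `L/res-L1-w43-stub-7/S3RHOD-ROADMAP.md`, part A.  MODEL: S. Perlega, thesis Wien 2017 /
arXiv:2011.14443, Ch. 5 §1: the expansion `f̃_i = Σ_{k ≥ i} C(k,i) f_k g^{k−i}` of `f` in `(x, z̃)`, `z = z̃ + g` (Lemma
coordinate_change_g_z), Lemma (c−q) on binomials (`C(c,i) = 0` for `c − q < i < c`, `C(c, c−q) ≠ 0`, `q = p^{ord_p c}`), and Lemma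
5.1.1 (1) («if `w(g) ≥ m/c!` then `w(J̃_{-1}) ≥ w(J_{-1})`»).  Nothing here is a statement of H. Hironaka's manuscript
[claim: Hironaka2017, status: under-review]; OUR objects: the tuple `A`, res-type-083's `WildMonic.shift d A g` (the re-centred tuple),
the scaled slot orders `WildMonic.slotWOrd` / `wMin` of `…WildMonicWClean`.]

* `natCast_choose_eq_zero_of_lt_qOf`, `natCast_choose_qOf_ne_zero`, `natCast_choose_eq_zero_of_gt` — Lemma (c−q) in `k` of
  characteristic `p` (via `(X+1)^d = expand_q (X+1)^{d/q}` in `k[X]`);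
* `shift_eq` — THE EXPANSION: `shift d A g i = C(d,i) g^{d−i} + Σ_j C(j,i) A_j g^{j−i}`;
* weighted-order helpers on `k[[x₁,x₂]]` (a valuation): `weightedOrder_pow_eq`, `weightedOrder_C_mul_of_ne_zero`,
  `le_weightedOrder_finset_sum`, `weightedOrder_finset_sum_eq_of_lt` (a sum with one strictly smallest term),
  `weightedOrder_add_eq_of_coeff` (two terms of equal order whose sum keeps a surviving coefficient);
* `slot_term_identity` — the bookkeeping identity `(d−i)·N_i·ord_w(A_j g^{j−i}) = (d−j)·s_j + (j−i)·G` (`s_j = slotWOrd`, `G = d!·ord_w g`),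
  `slot_top_identity` (`(d−i)·N_i·ord_w(g^{d−i}) = (d−i)·G`);
* `wMin_le_slotWOrd_shift` — PERLEGA LEMMA 5.1.1 (1): if `G ≥ m` then every scaled slot order of the re-centred tuple is `≥ m`, i.e.
  `wMin w A ≤ wMin w (shift d A g)` (`wMin_le_wMin_shift`).
Part B (`…WildMonicShiftOrderCases`): Lemma 5.1.1 (2)/(3) and Prop. 5.1.3 (`w`-clean ⇒ the re-centred `m` does not exceed `m`).
-/

set_option linter.dupNamespace false -- mandated namespace of this single-conjunct summit

namespace Summit.ResolutionOfSingularities.ResolutionOfSingularities.Theorems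

namespace WildMonic

open MvPowerSeries

/-! ## Lemma (c − q): binomial coefficients of `d` modulo `p` -/

section Binomial

/-- `d = q · (d/q)` with `q = qOf p d`. -/
theorem qOf_mul_ordCompl (p d : ℕ) : qOf p d * (d / qOf p d) = d :=
  Nat.ordProj_mul_ordCompl_eq_self d p

/-- `q = qOf p d` is positive. -/
theorem qOf_pos (p d : ℕ) : 0 < qOf p d := Nat.ordProj_pos d p

variable {k : Type} [Field k] (p : ℕ) [Fact p.Prime] [CharP k p]

/-- The key identity in `k[X]`: `(X + 1)^d = expand_q ((X + 1)^{d/q})` (Frobenius: `(X+1)^q = X^q + 1`). -/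
theorem X_add_one_pow_eq_expand (d : ℕ) :
    ((Polynomial.X + 1 : Polynomial k) ^ d) =
      Polynomial.expand k (qOf p d) ((Polynomial.X + 1) ^ (d / qOf p d)) := by
  conv_lhs => rw [← qOf_mul_ordCompl p d, pow_mul]
  rw [map_pow, map_add, Polynomial.expand_X, map_one]
  unfold qOf
  rw [add_pow_char_pow]
  simp

/-- `C(d, j) = 0` in `k` for `0 < j < q`. -/
theorem natCast_choose_eq_zero_of_lt_qOf {d j : ℕ} (hj0 : 0 < j) (hjq : j < qOf p d) : ((d.choose j : ℕ) : k) = 0 := by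
  have h := congrArg (fun P : Polynomial k => P.coeff j) (X_add_one_pow_eq_expand (k := k) p d)
  simp only [Polynomial.coeff_X_add_one_pow, Polynomial.coeff_expand (qOf_pos p d)] at h
  rw [h, if_neg]
  exact fun hdvd => absurd (Nat.le_of_dvd hj0 hdvd) (not_le.mpr hjq)

/-- `C(d, q) ≠ 0` in `k` (`d > 0`): it is `d/q`, prime to `p`. -/
theorem natCast_choose_qOf_ne_zero {d : ℕ} (hd : 0 < d) : ((d.choose (qOf p d) : ℕ) : k) ≠ 0 := by
  have hp : p.Prime := Fact.out
  have h := congrArg (fun P : Polynomial k => P.coeff (qOf p d)) (X_add_one_pow_eq_expand (k := k) p d)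
  simp only [Polynomial.coeff_X_add_one_pow, Polynomial.coeff_expand (qOf_pos p d), dvd_refl, if_true,
    Nat.div_self (qOf_pos p d), Nat.choose_one_right] at h
  rw [h, Ne, CharP.cast_eq_zero_iff k p]
  exact Nat.not_dvd_ordCompl hp hd.ne'

/-- `C(d, i) = 0` in `k` for `d − q < i < d` (the symmetric form used for the slots). -/
theorem natCast_choose_eq_zero_of_gt {d i : ℕ} (hi : d - qOf p d < i) (hid : i < d) : ((d.choose i : ℕ) : k) = 0 := by
  rw [← Nat.choose_symm hid.le]
  have hq : qOf p d ≤ d := Nat.le_of_dvd (by omega) (qOf_dvd p d)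
  exact natCast_choose_eq_zero_of_lt_qOf p (by omega) (by omega)

end Binomial

/-! ## The expansion of the re-centred tuple -/

section ShiftFormula

variable {R : Type*} [CommRing R]

/-- THE EXPANSION OF THE RE-CENTRED TUPLE (Perlega's `f̃_i = Σ_{k≥i} C(k,i) f_k g^{k−i}` with `f_d = 1`):
`shift d A g i = C(d,i)·g^{d−i} + Σ_j C(j,i)·A_j·g^{j−i}` (terms with `j < i` vanish as `C(j,i) = 0`). -/
theorem shift_eq {d : ℕ} (A : Fin d → R) (g : R) (i : Fin d) :
    shift d A g i = (d.choose i : R) * g ^ (d - (i : ℕ)) + ∑ j : Fin d, ((j : ℕ).choose i : R) * A j * g ^ ((j : ℕ) - i) := by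
  unfold shift monicPoly
  rw [Polynomial.taylor_apply, Polynomial.add_comp, Polynomial.X_pow_comp, Polynomial.sum_comp, Polynomial.coeff_add,
    Polynomial.finsetSum_coeff, Polynomial.coeff_X_add_C_pow]
  congr 1
  · ring
  · refine Finset.sum_congr rfl fun j _ => ?_
    rw [Polynomial.mul_comp, Polynomial.C_comp, Polynomial.X_pow_comp, Polynomial.coeff_C_mul, Polynomial.coeff_X_add_C_pow]
    ring

end ShiftFormula

/-! ## Weighted-order helpers on `k[[x]]` -/

section WeightedOrder

variable {k : Type} [Field k] {σ : Type*} (w : σ → ℕ)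

/-- `ord_w(g^n) = n · ord_w(g)` over a field. -/
theorem weightedOrder_pow_eq (g : MvPowerSeries σ k) (n : ℕ) : (g ^ n).weightedOrder w = n * g.weightedOrder w := by
  induction n with
  | zero => simp [weightedOrder_one]
  | succ n ih => rw [pow_succ, weightedOrder_mul, ih]; push_cast; ring

/-- `ord_w(c · f) = ord_w(f)` for a non-zero scalar `c`. -/
theorem weightedOrder_C_mul_of_ne_zero {c : k} (hc : c ≠ 0) (f : MvPowerSeries σ k) :
    (C c * f).weightedOrder w = f.weightedOrder w := by
  rw [weightedOrder_mul, ← monomial_zero_eq_C_apply, weightedOrder_monomial_of_ne_zero w hc]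
  simp

/-- `ord_w` of a finite sum is at least the least `ord_w` of a summand. -/
theorem le_weightedOrder_finset_sum {ι : Type*} (s : Finset ι) (f : ι → MvPowerSeries σ k) {n : ℕ∞}
    (h : ∀ i ∈ s, n ≤ (f i).weightedOrder w) : n ≤ (∑ i ∈ s, f i).weightedOrder w := by
  classical
  induction s using Finset.induction_on with
  | empty => simp
  | insert a s ha ih =>
    rw [Finset.sum_insert ha]
    exact le_trans (le_min (h a (Finset.mem_insert_self a s)) (ih fun i hi => h i (Finset.mem_insert_of_mem hi)))
      (min_weightedOrder_le_add w)

/-- A finite sum with ONE strictly smallest term has the order of that term. -/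
theorem weightedOrder_finset_sum_eq_of_lt {ι : Type*} (s : Finset ι) (f : ι → MvPowerSeries σ k) {i₀ : ι} (hi₀ : i₀ ∈ s)
    (h : ∀ i ∈ s, i ≠ i₀ → (f i₀).weightedOrder w < (f i).weightedOrder w) :
    (∑ i ∈ s, f i).weightedOrder w = (f i₀).weightedOrder w := by
  classical
  rw [← Finset.add_sum_erase s f hi₀]
  by_cases htop : (f i₀).weightedOrder w = ⊤
  · rw [weightedOrder_eq_top_iff] at htop
    have hzero : ∀ i ∈ s.erase i₀, f i = 0 := fun i hi => by
      have hlt := h i (Finset.mem_of_mem_erase hi) (Finset.ne_of_mem_erase hi)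
      rw [htop, weightedOrder_zero] at hlt
      exact absurd hlt (not_lt.mpr le_top)
    rw [Finset.sum_eq_zero hzero, add_zero]
  · have hlt : (f i₀).weightedOrder w < (∑ i ∈ s.erase i₀, f i).weightedOrder w := by
      obtain ⟨n, hn⟩ := ENat.ne_top_iff_exists.mp htop
      rw [← hn]
      refine lt_of_lt_of_le (ENat.coe_lt_coe.mpr (Nat.lt_succ_self n)) (le_weightedOrder_finset_sum w _ _ fun i hi => ?_)
      have hlt := h i (Finset.mem_of_mem_erase hi) (Finset.ne_of_mem_erase hi)
      rw [← hn] at hlt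
      exact Order.add_one_le_of_lt hlt
    rw [weightedOrder_add_of_weightedOrder_ne w hlt.ne, min_eq_left hlt.le]

/-- Two terms of comparable order whose sum keeps a SURVIVING COEFFICIENT of the first at its order level: `ord_w(F + H) = ord_w(F)`. -/
theorem weightedOrder_add_eq_of_coeff {F H : MvPowerSeries σ k} {e : σ →₀ ℕ} (hF : coeff e F ≠ 0)
    (hwe : ((Finsupp.weight w e : ℕ) : ℕ∞) = F.weightedOrder w) (hH : F.weightedOrder w ≤ H.weightedOrder w)
    (hHe : coeff e H = 0) : (F + H).weightedOrder w = F.weightedOrder w := by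
  apply le_antisymm
  · rw [← hwe]
    exact weightedOrder_le w (by rw [map_add, hHe, add_zero]; exact hF)
  · exact le_trans (le_min le_rfl hH) (min_weightedOrder_le_add w)

end WeightedOrder

/-! ## The slot bookkeeping identities and Lemma 5.1.1 (1) -/

section Slots

variable {k : Type} [Field k] (w : Fin 2 → ℕ) {d : ℕ} (A : Fin d → MvPowerSeries (Fin 2) k) (g : MvPowerSeries (Fin 2) k)

/-- `wMin ≤` every scaled slot order. -/
theorem wMin_le_slotWOrd (j : Fin d) : wMin w A ≤ slotWOrd w A j := iInf_le _ j

/-- `(d − i) · N_i = d!`. -/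
theorem sub_mul_slotWeight (i : Fin d) : (d - (i : ℕ)) * slotWeight d i = d.factorial := by
  rw [mul_comm, slotWeight_mul_sub]

/-- THE TERM IDENTITY: `(d−i) · N_i · ord_w(A_j · g^{j−i}) = (d−j) · s_j + (j−i) · G`, `s_j = slotWOrd w A j`, `G = d! · ord_w g`
(`i ≤ j`). -/
theorem slot_term_identity (i j : Fin d) :
    ((d - (i : ℕ) : ℕ) : ℕ∞) * ((slotWeight d i : ℕ∞) * (A j * g ^ ((j : ℕ) - i)).weightedOrder w) =
      ((d - (j : ℕ) : ℕ) : ℕ∞) * slotWOrd w A j + (((j : ℕ) - i : ℕ) : ℕ∞) * ((d.factorial : ℕ∞) * g.weightedOrder w) := by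
  unfold slotWOrd
  rw [weightedOrder_mul, weightedOrder_pow_eq]
  have h1 : ((d - (i : ℕ) : ℕ) : ℕ∞) * (slotWeight d i : ℕ∞) = (d.factorial : ℕ∞) := by
    rw [← Nat.cast_mul, sub_mul_slotWeight]
  have h2 : ((d - (j : ℕ) : ℕ) : ℕ∞) * (slotWeight d j : ℕ∞) = (d.factorial : ℕ∞) := by
    rw [← Nat.cast_mul, sub_mul_slotWeight]
  calc ((d - (i : ℕ) : ℕ) : ℕ∞) * ((slotWeight d i : ℕ∞) * ((A j).weightedOrder w + ((((j : ℕ) - i : ℕ) : ℕ∞)) * g.weightedOrder w))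
      = (((d - (i : ℕ) : ℕ) : ℕ∞) * (slotWeight d i : ℕ∞)) * (A j).weightedOrder w +
          (((j : ℕ) - i : ℕ) : ℕ∞) * ((((d - (i : ℕ) : ℕ) : ℕ∞) * (slotWeight d i : ℕ∞)) * g.weightedOrder w) := by ring
    _ = (((d - (j : ℕ) : ℕ) : ℕ∞) * (slotWeight d j : ℕ∞)) * (A j).weightedOrder w +
          (((j : ℕ) - i : ℕ) : ℕ∞) * ((d.factorial : ℕ∞) * g.weightedOrder w) := by rw [h1, h2]
    _ = _ := by ring

/-- THE TOP-TERM IDENTITY: `(d−i) · N_i · ord_w(g^{d−i}) = (d−i) · G`. -/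
theorem slot_top_identity (i : Fin d) :
    ((d - (i : ℕ) : ℕ) : ℕ∞) * ((slotWeight d i : ℕ∞) * (g ^ (d - (i : ℕ))).weightedOrder w) =
      ((d - (i : ℕ) : ℕ) : ℕ∞) * ((d.factorial : ℕ∞) * g.weightedOrder w) := by
  rw [weightedOrder_pow_eq]
  have h1 : ((d - (i : ℕ) : ℕ) : ℕ∞) * (slotWeight d i : ℕ∞) = (d.factorial : ℕ∞) := by
    rw [← Nat.cast_mul, sub_mul_slotWeight]
  calc ((d - (i : ℕ) : ℕ) : ℕ∞) * ((slotWeight d i : ℕ∞) * ((((d - (i : ℕ) : ℕ)) : ℕ∞) * g.weightedOrder w))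
      = ((d - (i : ℕ) : ℕ) : ℕ∞) * ((((d - (i : ℕ) : ℕ) : ℕ∞) * (slotWeight d i : ℕ∞)) * g.weightedOrder w) := by ring
    _ = _ := by rw [h1]

/-- Cancelling the positive finite factor `(d − i)`. -/
theorem le_of_sub_mul_le (i : Fin d) {x y : ℕ∞} (h : ((d - (i : ℕ) : ℕ) : ℕ∞) * x ≤ ((d - (i : ℕ) : ℕ) : ℕ∞) * y) :
    x ≤ y :=
  (ENat.mul_le_mul_left_iff (by have := i.2; exact_mod_cast (show (d - (i : ℕ) : ℕ) ≠ 0 by omega)) (ENat.coe_ne_top _)).mp h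

/-- Strict version. -/
theorem lt_of_sub_mul_lt (i : Fin d) {x y : ℕ∞} (h : ((d - (i : ℕ) : ℕ) : ℕ∞) * x < ((d - (i : ℕ) : ℕ) : ℕ∞) * y) : x < y :=
  lt_of_mul_lt_mul_left h bot_le

/-- `ord_w(c·f) ≥ ord_w(f)` for a natural-number scalar. -/
theorem weightedOrder_le_natCast_mul (n : ℕ) (f : MvPowerSeries (Fin 2) k) :
    f.weightedOrder w ≤ ((n : MvPowerSeries (Fin 2) k) * f).weightedOrder w := by
  rw [← map_natCast (C : k →+* MvPowerSeries (Fin 2) k) n]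
  exact le_trans (by simp) (le_weightedOrder_mul w)

/-- A LOWER BOUND FOR ONE TERM of `shift d A g i`: `N_i · ord_w(C(j,i) A_j g^{j−i}) ≥ min(m, G)`. -/
theorem min_le_slotWeight_mul_weightedOrder_term (i j : Fin d) :
    min (wMin w A) ((d.factorial : ℕ∞) * g.weightedOrder w) ≤
      (slotWeight d i : ℕ∞) * ((((j : ℕ).choose i : ℕ) : MvPowerSeries (Fin 2) k) * A j * g ^ ((j : ℕ) - i)).weightedOrder w := by
  by_cases hij : (i : ℕ) ≤ j
  · -- `(d−i)·N_i·ν(term) ≥ (d−i)·N_i·ν(A_j g^{j−i}) = (d−j)s_j + (j−i)G ≥ (d−i)·min(m,G)`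
    have hmono : (A j * g ^ ((j : ℕ) - i)).weightedOrder w ≤
        ((((j : ℕ).choose i : ℕ) : MvPowerSeries (Fin 2) k) * A j * g ^ ((j : ℕ) - i)).weightedOrder w := by
      rw [mul_assoc]; exact weightedOrder_le_natCast_mul w _ _
    refine le_of_sub_mul_le i ?_
    have hij' : (((j : ℕ) - i : ℕ) : ℕ∞) + ((d - (j : ℕ) : ℕ) : ℕ∞) = ((d - (i : ℕ) : ℕ) : ℕ∞) := by
      rw [← Nat.cast_add]; congr 1; have := j.2; omega
    have hm1 : min (wMin w A) ((d.factorial : ℕ∞) * g.weightedOrder w) ≤ slotWOrd w A j :=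
      le_trans (min_le_left _ _) (wMin_le_slotWOrd w A j)
    have hm2 : min (wMin w A) ((d.factorial : ℕ∞) * g.weightedOrder w) ≤ (d.factorial : ℕ∞) * g.weightedOrder w :=
      min_le_right _ _
    calc ((d - (i : ℕ) : ℕ) : ℕ∞) * min (wMin w A) ((d.factorial : ℕ∞) * g.weightedOrder w)
        = ((d - (j : ℕ) : ℕ) : ℕ∞) * min (wMin w A) ((d.factorial : ℕ∞) * g.weightedOrder w) +
            (((j : ℕ) - i : ℕ) : ℕ∞) * min (wMin w A) ((d.factorial : ℕ∞) * g.weightedOrder w) := by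
          rw [← add_mul, add_comm, hij']
      _ ≤ ((d - (j : ℕ) : ℕ) : ℕ∞) * slotWOrd w A j + (((j : ℕ) - i : ℕ) : ℕ∞) * ((d.factorial : ℕ∞) * g.weightedOrder w) := by
          gcongr
      _ = ((d - (i : ℕ) : ℕ) : ℕ∞) * ((slotWeight d i : ℕ∞) * (A j * g ^ ((j : ℕ) - i)).weightedOrder w) :=
          (slot_term_identity w A g i j).symm
      _ ≤ ((d - (i : ℕ) : ℕ) : ℕ∞) * ((slotWeight d i : ℕ∞) *
            ((((j : ℕ).choose i : ℕ) : MvPowerSeries (Fin 2) k) * A j * g ^ ((j : ℕ) - i)).weightedOrder w) := by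
          gcongr
  · -- `C(j,i) = 0`
    rw [Nat.choose_eq_zero_of_lt (not_le.mp hij), Nat.cast_zero, zero_mul, zero_mul, weightedOrder_zero, ENat.mul_top
      (by exact_mod_cast (slotWeight_pos i).ne')]
    exact le_top

/-- A LOWER BOUND FOR THE TOP TERM: `N_i · ord_w(C(d,i) g^{d−i}) ≥ G`. -/
theorem le_slotWeight_mul_weightedOrder_top (i : Fin d) :
    (d.factorial : ℕ∞) * g.weightedOrder w ≤
      (slotWeight d i : ℕ∞) * (((d.choose i : ℕ) : MvPowerSeries (Fin 2) k) * g ^ (d - (i : ℕ))).weightedOrder w := by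
  refine le_of_sub_mul_le i ?_
  calc ((d - (i : ℕ) : ℕ) : ℕ∞) * ((d.factorial : ℕ∞) * g.weightedOrder w)
      = ((d - (i : ℕ) : ℕ) : ℕ∞) * ((slotWeight d i : ℕ∞) * (g ^ (d - (i : ℕ))).weightedOrder w) := (slot_top_identity w g i).symm
    _ ≤ ((d - (i : ℕ) : ℕ) : ℕ∞) * ((slotWeight d i : ℕ∞) *
          (((d.choose i : ℕ) : MvPowerSeries (Fin 2) k) * g ^ (d - (i : ℕ))).weightedOrder w) := by
        gcongr
        exact weightedOrder_le_natCast_mul w _ _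

/-- A scaled lower bound passes to a sum. -/
theorem le_mul_weightedOrder_add {c n : ℕ∞} {F H : MvPowerSeries (Fin 2) k} (hF : n ≤ c * F.weightedOrder w)
    (hH : n ≤ c * H.weightedOrder w) : n ≤ c * (F + H).weightedOrder w := by
  have hmin : min (c * F.weightedOrder w) (c * H.weightedOrder w) ≤ c * (F + H).weightedOrder w := by
    rcases le_total (F.weightedOrder w) (H.weightedOrder w) with h | h
    · exact le_trans (min_le_left _ _) (by gcongr; exact le_trans (le_min le_rfl h) (min_weightedOrder_le_add w))
    · exact le_trans (min_le_right _ _) (by gcongr; exact le_trans (le_min h le_rfl) (min_weightedOrder_le_add w))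
  exact le_trans (le_min hF hH) hmin

/-- A scaled lower bound passes to a finite sum. -/
theorem le_mul_weightedOrder_finset_sum {ι : Type*} (s : Finset ι) (f : ι → MvPowerSeries (Fin 2) k) {c n : ℕ∞} (hc : c ≠ 0)
    (h : ∀ i ∈ s, n ≤ c * (f i).weightedOrder w) : n ≤ c * (∑ i ∈ s, f i).weightedOrder w := by
  classical
  induction s using Finset.induction_on with
  | empty => rw [Finset.sum_empty, weightedOrder_zero, ENat.mul_top hc]; exact le_top
  | insert a s ha ih =>
    rw [Finset.sum_insert ha]
    exact le_mul_weightedOrder_add w (h a (Finset.mem_insert_self a s)) (ih fun i hi => h i (Finset.mem_insert_of_mem hi))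

/-- PERLEGA LEMMA 5.1.1 (1), SLOT BY SLOT: if `G = d!·ord_w(g) ≥ m` then every scaled slot order of the re-centred tuple is `≥ m`. -/
theorem wMin_le_slotWOrd_shift (hG : wMin w A ≤ (d.factorial : ℕ∞) * g.weightedOrder w) (i : Fin d) :
    wMin w A ≤ slotWOrd w (shift d A g) i := by
  unfold slotWOrd
  rw [shift_eq]
  have hc : (slotWeight d i : ℕ∞) ≠ 0 := by exact_mod_cast (slotWeight_pos i).ne'
  refine le_mul_weightedOrder_add w (le_trans hG (le_slotWeight_mul_weightedOrder_top w g i))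
    (le_mul_weightedOrder_finset_sum w _ _ hc fun j _ => ?_)
  exact le_trans (le_min le_rfl hG) (min_le_slotWeight_mul_weightedOrder_term w A g i j)

/-- PERLEGA LEMMA 5.1.1 (1): `G ≥ m ⇒ m(shift d A g) ≥ m(A)`. -/
theorem wMin_le_wMin_shift (hG : wMin w A ≤ (d.factorial : ℕ∞) * g.weightedOrder w) :
    wMin w A ≤ wMin w (shift d A g) :=
  le_iInf fun i => wMin_le_slotWOrd_shift w A g hG i

end Slots

end WildMonic

end Summit.ResolutionOfSingularities.ResolutionOfSingularities.Theorems
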